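import Mathlib
import HarnessLib
import Summits.HubbardSuperconductivity.HubbardSuperconductivity.Theorems.KLProgrammeKLRegimeCountertermFrameExtGData
import Summits.HubbardSuperconductivity.HubbardSuperconductivity.Theorems.KLProgrammeKLRegimeCountertermFlatTubeSite
import Summits.HubbardSuperconductivity.HubbardSuperconductivity.Theorems.KLProgrammeKLRegimeSplitAngularLipschitz

/-!
# Route `KLProgramme`, crux K3 (stmt-HubbardSuperconductivity-19937) — THE OFF-LATTICE WIGGLE OF A G-EXTENSION: near its level curve a
# G-extended symmetric Lipschitz angular profile reads the profile up to `O(1/L)`,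
# `|(klFrameExtG L μ f)(q) − f(θ(q))| ≤ 2π·Λ_K/L + 2π²·Λ_f/(r·L)`

Cell gate-hubbard-kl, seat p1b (g4).  Steps (1)+(2) of the child-2 closing route under the Δ18 repair (child `KLRegimeCountertermV9/V10`,
stmt-…-19664; STATUS 2026-08-26 l.994) assembled into ONE inequality the child-2 prover applies at `q = klFermiPoint μ K θ` with
`φ = K∘k_F − ν_N(K)` (so that `K = klFrameExtG L μ φ` for the (stage-)fixed point and the left side is `ν_N(K)(θ)` up to the angle
identification `polarAngle (t·dir θ) ≡ θ`): for `K = klFrameExtG L μ f` with `f` `2π`-periodic, even, quarter-turn invariant and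
`Λ_f`-Lipschitz, `K` `Λ_K`-Lipschitz in the sup metric of momenta (consumer: `abs_eval_sub_eval_le` with `coeffNorm 1`, or a gradient bound),
`μ ≤ −1/10`, and a point `q` of the level curve `{ε₀ = μ + κ}` with `|κ| ≤ klFlatR/2`, seam margin `|qᵢ| ≤ π − 2π/L`, `8π/klFlatR ≤ L`,
`‖q‖ ≥ r > 2π/L`:  **`|K(q) − f(polarAngle q)| ≤ Λ_K·(2π/L) + Λ_f·π·(2π/L)/r`** (`abs_eval_klFrameExtG_sub_le`).
Chain: nearest flat-tube site `k` of `q` (`exists_site_near_levelPoint_flatTube`) → `K(q) ≈ K(p̃_k)` (Lipschitz, distance `π/L` per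
coordinate) → `K(p̃_k) = K(p_k)` (`eval_torusCentredMomentum`, periodicity) → `K(p_k) = f(θ(k))` (grid reading
`eval_klFrameExtG_latticeMomentum_of_flat_of_symm`) → `f(θ(k)) ≈ f(θ(q))` (`abs_sub_polarAngle_le_of_sup`).  Proofs only.
-/

noncomputable section

namespace Summit.HubbardSuperconductivity.HubbardSuperconductivity.Theorems.KLRegimeSplit

set_option linter.dupNamespace false -- summit = problem name (single-conjunct summit), D-0017

open Real Literature.MathematicalPhysics.QuantumLattice Literature.Probability.LatticeModels
open Literature.MathematicalPhysics.QuantumLattice.BandSectorCounting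

variable (L : ℕ) [NeZero L]

omit [NeZero L] in
/-- **A frame takes the same value at the centred and at the standard representative of a torus momentum** (`2π`-periodicity). -/
theorem eval_torusCentredMomentum (K : TrigPolyC4v) (k : TorusSite 2 L) :
    K.eval (torusCentredMomentum L k) = K.eval (latticeMomentum L k) := by
  have h : torusCentredMomentum L k =
      fun i => latticeMomentum L k i + ((-toIocDiv Real.two_pi_pos (-π) (latticeMomentum L k i) : ℤ) : ℝ) * (2 * π) := by
    funext i
    simp only [torusCentredMomentum, toIocMod]
    push_cast
    ring
  rw [h, TrigPolyC4v.eval_periodic]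

omit [NeZero L] in
/-- `momentumAngle` is the polar angle of the centred representative (definitional). -/
theorem momentumAngle_eq_polarAngle (k : TorusSite 2 L) : momentumAngle L k = polarAngle (torusCentredMomentum L k) := rfl

/-- **THE OFF-LATTICE WIGGLE OF A G-EXTENSION.**  See the module docstring. -/
theorem abs_eval_klFrameExtG_sub_le {μ : ℝ} (hμ : μ ≤ -(1 / 10)) {f : ℝ → ℝ} (hper : Function.Periodic f (2 * π))
    (heven : ∀ θ, f (-θ) = f θ) (hquart : ∀ θ, f (θ + π / 2) = f θ) {Λf : ℝ} (hΛf : 0 ≤ Λf)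
    (hLipf : ∀ a b, |f a - f b| ≤ Λf * |a - b|) {ΛK : ℝ} (hΛK : 0 ≤ ΛK)
    (hLipK : ∀ p p' : Fin 2 → ℝ, |(klFrameExtG L μ f).eval p - (klFrameExtG L μ f).eval p'| ≤ ΛK * (|p 0 - p' 0| + |p 1 - p' 1|))
    {q : Fin 2 → ℝ} (hq : ∀ i, |q i| ≤ π - 2 * π / L) {κ : ℝ} (hε : eps2 (q 0) (q 1) = μ + κ) (hκ : |κ| ≤ klFlatR / 2)
    (hL : 8 * π / klFlatR ≤ L) {r : ℝ} (hr : 2 * π / L < r) (hrq : r ≤ ‖momToComplex q‖) :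
    |(klFrameExtG L μ f).eval q - f (polarAngle q)| ≤ ΛK * (2 * π / L) + Λf * π * (2 * (π / L) / r) := by
  have hLpos : (0 : ℝ) < L := Nat.cast_pos.2 (Nat.pos_of_ne_zero (NeZero.ne L))
  have hπL : 0 < 2 * π / L := by positivity
  have hr0 : 0 < r := hπL.trans hr
  set K := klFrameExtG L μ f with hKdef
  -- the nearest flat-tube site
  obtain ⟨k, hk, hξ⟩ := exists_site_near_levelPoint_flatTube L hq hε hκ hL
  -- (a) K(q) ≈ K(centred k)
  have ha : |K.eval q - K.eval (torusCentredMomentum L k)| ≤ ΛK * (2 * π / L) := by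
    refine (hLipK q (torusCentredMomentum L k)).trans ?_
    have h0 := hk 0; have h1 := hk 1
    rw [abs_sub_comm] at h0 h1
    calc ΛK * (|q 0 - torusCentredMomentum L k 0| + |q 1 - torusCentredMomentum L k 1|) ≤ ΛK * (π / L + π / L) :=
          mul_le_mul_of_nonneg_left (add_le_add h0 h1) hΛK
      _ = ΛK * (2 * π / L) := by ring
  -- (b) K(centred k) = K(p_k) = f(θ(k))
  have hb : K.eval (torusCentredMomentum L k) = f (momentumAngle L k) := by
    rw [eval_torusCentredMomentum, hKdef]
    exact eval_klFrameExtG_latticeMomentum_of_flat_of_symm L hμ hper heven hquart hξ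
  -- (c) f(θ(k)) ≈ f(θ(q))
  have hq0 : q ≠ 0 := by
    intro h0
    have : ‖momToComplex q‖ = 0 := by rw [h0]; simp [momToComplex]
    linarith
  have hc0 : torusCentredMomentum L k ≠ 0 := by
    intro h0
    have hd : ‖momToComplex q - momToComplex (torusCentredMomentum L k)‖ ≤ |q 0 - torusCentredMomentum L k 0| +
        |q 1 - torusCentredMomentum L k 1| := norm_momToComplex_sub_le _ _
    have h0' : momToComplex (torusCentredMomentum L k) = 0 := by rw [h0]; simp [momToComplex]
    rw [h0', sub_zero] at hd
    have h0'' := hk 0; have h1'' := hk 1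
    rw [abs_sub_comm] at h0'' h1''
    have e2 : π / (L : ℝ) + π / L = 2 * π / L := by ring
    have : ‖momToComplex q‖ ≤ 2 * π / L := by linarith
    linarith
  have hc : |f (momentumAngle L k) - f (polarAngle q)| ≤ Λf * π * (2 * (π / L) / r) := by
    rw [abs_sub_comm, momentumAngle_eq_polarAngle]
    refine abs_sub_polarAngle_le_of_sup hper hΛf hLipf hq0 hc0 hr0 hrq fun i => ?_
    have := hk i
    rw [abs_sub_comm] at this
    exact this
  -- assemble
  calc |K.eval q - f (polarAngle q)|
      = |(K.eval q - K.eval (torusCentredMomentum L k)) + (f (momentumAngle L k) - f (polarAngle q))| := by rw [← hb]; ring_nf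
    _ ≤ |K.eval q - K.eval (torusCentredMomentum L k)| + |f (momentumAngle L k) - f (polarAngle q)| := abs_add_le _ _
    _ ≤ ΛK * (2 * π / L) + Λf * π * (2 * (π / L) / r) := add_le_add ha hc

end Summit.HubbardSuperconductivity.HubbardSuperconductivity.Theorems.KLRegimeSplit

end
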